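import Literature.Analysis.FluidPDE.TorusNSBeiraoDaVeigaCriterion
import Literature.Analysis.FluidPDE.TorusGradientVorticityLp
import HarnessLib

/-!
# The strain criterion `S ∈ L^r(0,T; L^s)`, `2/r + 3/s = 2`, `3/2 < s < ∞`, for classical
# Navier–Stokes solutions on `T³` (continuation form)

search for candidate a priori estimates; no regularity claim (cell `pub-nsfunc`, literature seat:
this file types a PUBLISHED criterion in the strain vocabulary, nothing new).

Analysis/FluidPDE proof file (theorems only; no definitions, no named facts), the strain twin of
`TorusNSVorticityLsCriterion.lean`. Beirão da Veiga's gradient criterion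
(`∇u ∈ L^r(0,T;L^s)`, `2/r + 3/s = 2`, `3/2 < s < ∞`; on `T³` in continuation form:
`Torus.classicalNS_continuation_of_gradLs_rpow_integral_le`) composed with the periodic
Calderón–Zygmund bound controlling the full gradient by the strain-rate tensor
`S = ½(∇u + ∇uᵀ)` of a divergence-free field — `u = −2 div(−Δ)⁻¹S`, "the strain-to-gradient
operator is Calderón–Zygmund bounded on `L^p`, `1 < p < ∞`" (Miller, Arch. Ration. Mech. Anal.
235 (2020), §3; tree: `BDSV.exists_eLpNorm_partialDeriv_le_twoStrain` of `TorusGradientVorticityLp`)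
— gives the criterion in terms of `|S|` alone, the form used for strain moments (Miller 2020
Thm 1.3 ff.: regularity criteria on the strain; the `|S|` criterion is the `L^rL^s` gradient
criterion restated, since `‖∇u‖_s ≈ ‖S‖_s ≈ ‖ω‖_s` for `1 < s < ∞`):

* `Torus.exists_gradLs_le_strainLs` — for `1 < s` there is `K` with
  `(∫ |∇v|^s)^{1/s} ≤ K (∫ |S|^s)^{1/s}` for every smooth divergence-free `v` on `T³`,
  `|∇v| = (∑ⱼ‖∂ⱼv‖²)^{1/2}`, `|S|² = ∑ᵢⱼ (((∂ⱼv)ᵢ + (∂ᵢv)ⱼ)/2)²` (written out; it is the cell's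
  `torusStrainSqAt v x` of `Summits/…/FunctionalMining/StrainMoment`, definitionally).
* `Torus.classicalNS_continuation_of_strainLs_rpow_integral_le` — **the strain criterion on `T³`,
  continuation form**: along a classical solution of the unforced Navier–Stokes equations
  (`ν > 0`, mean-zero slices) on `[0, T) × T³`, a continuous majorant `N(t) ≥ ‖S(t)‖_{L^s}`,
  `3/2 < s < ∞`, with `∫₀ᵗ N^{2s/(2s−3)} ≤ I` on `[0, T)` gives continuation past `T`.

Scope (faithfulness): `T³ = UnitAddTorus (Fin 3)` only (the Calderón–Zygmund file is stated on
`Fin 3`); classical solutions with mean-zero slices, continuous majorant with bounded primitive in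
place of `S ∈ L^r(0,T;L^s)`; `s = 3/2` excluded as in print; constants inexplicit. This is the
CRITERION column for the dictionary's strain-moment rows (`ES.absS.q`, and via the pointwise
`λ₁ ≥ |S|/√6`, `−λ₃ ≥ |S|/√6` for trace-free `S` also `ES.lam1.q`, `ES.neglam3.q`), `2/r + 3/s = 2`.
-- TODO(general form): `card d = 3` index types (transfer `UnitAddTorus d ≃ T³`).

## Mathlib / tree search

Tree (used): `BDSV.exists_eLpNorm_partialDeriv_le_twoStrain` (`TorusGradientVorticityLp`),
`Torus.classicalNS_continuation_of_gradLs_rpow_integral_le` (`TorusNSBeiraoDaVeigaCriterion`);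
pattern of `TorusNSVorticityLsCriterion`. Searched `strainLs|twoStrain.*continuation|absS.*criterion`
under `Literature/`: nothing (the strain appears in criteria only through Miller's `λ₂⁺`,
`TorusNSMillerCriterion`, and the enstrophy–strain identity files).

## References

* [BeiraoDaVeiga1995] H. Beirão da Veiga, *A new regularity class for the Navier–Stokes
  equations in ℝⁿ*, Chinese Ann. Math. Ser. B 16 (1995) 407–412 (restated Robinson–Rodrigo–
  Sadowski 2016, Notes to Ch. 8, p. 135).
* [Miller2019] E. Miller, *A regularity criterion for the Navier–Stokes equation involving only
  the middle eigenvalue of the strain tensor*, Arch. Ration. Mech. Anal. 235 (2020) 99–139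
  (arXiv:1710.05569), §3 (strain-to-gradient Calderón–Zygmund operator).
-/

noncomputable section

open Set MeasureTheory intervalIntegral Filter Real
open scoped InnerProductSpace RealInnerProductSpace Topology ENNReal NNReal

namespace Literature.Analysis.FluidPDE

open Literature.Analysis.FunctionSpaces

/-- `√(∑ aᵢ²) ≤ ∑ aᵢ` for `aᵢ ≥ 0`. [folklore] -/
private theorem sqrt_sum_sq_le_sum₂ {ι : Type*} [Fintype ι] (a : ι → ℝ) (ha : ∀ i, 0 ≤ a i) :
    Real.sqrt (∑ i, a i ^ 2) ≤ ∑ i, a i := by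
  have hS : 0 ≤ ∑ i, a i := Finset.sum_nonneg fun i _ => ha i
  refine Real.sqrt_le_iff.2 ⟨hS, ?_⟩
  calc ∑ i, a i ^ 2 = ∑ i, a i * a i := Finset.sum_congr rfl fun i _ => sq (a i)
    _ ≤ ∑ i, a i * ∑ k, a k := Finset.sum_le_sum fun i _ =>
        mul_le_mul_of_nonneg_left (Finset.single_le_sum (fun k _ => ha k) (Finset.mem_univ i))
          (ha i)
    _ = (∑ i, a i) ^ 2 := by rw [← Finset.sum_mul]; ring

/-! ### `‖∇v‖_{L^s} ≤ K ‖S‖_{L^s}` in Bochner-integral form -/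

/-- **Calderón–Zygmund control of `|∇v|` by the strain `|S|` in `L^s(T³)`, `1 < s < ∞`, Bochner
form** (Miller 2020 §3: `v = −2 div(−Δ)⁻¹S`, a Calderón–Zygmund operator of `S`): for `1 < s`
there is `K ≥ 0` such that for every smooth divergence-free `v` on `T³`,
`(∫ |∇v|^s)^{1/s} ≤ K (∫ |S|^s)^{1/s}` with `|∇v| = (∑ⱼ‖∂ⱼv‖²)^{1/2}` and
`|S| = (∑ᵢⱼ(((∂ⱼv)ᵢ + (∂ᵢv)ⱼ)/2)²)^{1/2}` (from the componentwise `eLpNorm` bound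
`BDSV.exists_eLpNorm_partialDeriv_le_twoStrain`: `|∇v| ≤ ∑ₖᵢ|∂ₖvᵢ|`, `|(∂ᵢv)ⱼ + (∂ⱼv)ᵢ| ≤ 2|S|`,
Minkowski; `K = 54 C_s`). [cite: Miller2019, §3 (strain-to-gradient Calderón–Zygmund bound, 1 < p < ∞)] -/
theorem Torus.exists_gradLs_le_strainLs {s : ℝ} (hs : 1 < s) :
    ∃ K : ℝ, 0 ≤ K ∧ ∀ v : UnitAddTorus (Fin 3) → EuclideanSpace ℝ (Fin 3), Torus.IsSmooth v →
      Torus.IsDivFree v →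
      (∫ x, Real.sqrt (∑ j, ‖Torus.partialDeriv j v x‖ ^ 2) ^ s) ^ (1 / s) ≤
        K * (∫ x, Real.sqrt (∑ i, ∑ j,
          ((Torus.partialDeriv j v x i + Torus.partialDeriv i v x j) / 2) ^ 2) ^ s) ^ (1 / s) := by
  have hs0 : 0 < s := by linarith
  set q : ℝ≥0∞ := ENNReal.ofReal s with hq
  have hq1 : 1 < q := by rw [hq]; exact ENNReal.one_lt_ofReal.2 hs
  have hqtop : q < ⊤ := ENNReal.ofReal_lt_top
  have hq0 : q ≠ 0 := (zero_lt_one.trans hq1).ne'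
  have hqr : q.toReal = s := ENNReal.toReal_ofReal hs0.le
  obtain ⟨C, hC⟩ := BDSV.exists_eLpNorm_partialDeriv_le_twoStrain hq1 hqtop
  refine ⟨54 * C, by positivity, fun v hv hdiv => ?_⟩
  set f : UnitAddTorus (Fin 3) → ℝ :=
    fun x => Real.sqrt (∑ j, ‖Torus.partialDeriv j v x‖ ^ 2) with hf
  set g : UnitAddTorus (Fin 3) → ℝ := fun x => Real.sqrt (∑ i, ∑ j,
    ((Torus.partialDeriv j v x i + Torus.partialDeriv i v x j) / 2) ^ 2) with hg
  have hDc : ∀ j, Continuous (Torus.partialDeriv j v) := fun j => (hv.partialDeriv j).continuous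
  have hDic : ∀ j i, Continuous fun x => Torus.partialDeriv j v x i :=
    fun j i => (EuclideanSpace.proj i).continuous.comp (hDc j)
  have hfc : Continuous f :=
    Real.continuous_sqrt.comp (continuous_finsetSum _ fun j _ => ((hDc j).norm).pow 2)
  have hgc : Continuous g :=
    Real.continuous_sqrt.comp (continuous_finsetSum _ fun i _ => continuous_finsetSum _ fun j _ =>
      (((hDic j i).add (hDic i j)).div_const 2).pow 2)
  have hf0 : ∀ x, 0 ≤ f x := fun x => Real.sqrt_nonneg _
  have hg0 : ∀ x, 0 ≤ g x := fun x => Real.sqrt_nonneg _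
  -- pointwise: `f ≤ ∑ₖᵢ |∂ₖvᵢ|`, `|(∂ᵢv)ⱼ + (∂ⱼv)ᵢ| ≤ 2 g`
  set F : Fin 3 × Fin 3 → UnitAddTorus (Fin 3) → ℝ :=
    fun ki x => |Torus.partialDeriv ki.1 v x ki.2| with hF
  have hf_le : ∀ x, f x ≤ ∑ ki, F ki x := by
    intro x
    have h1 : f x ≤ ∑ j, ‖Torus.partialDeriv j v x‖ :=
      sqrt_sum_sq_le_sum₂ (fun j => ‖Torus.partialDeriv j v x‖) fun j => norm_nonneg _
    have h2 : ∀ j, ‖Torus.partialDeriv j v x‖ ≤ ∑ i, |Torus.partialDeriv j v x i| := by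
      intro j
      rw [EuclideanSpace.norm_eq]
      have e : ∀ i, ‖Torus.partialDeriv j v x i‖ ^ 2 = |Torus.partialDeriv j v x i| ^ 2 :=
        fun i => by rw [Real.norm_eq_abs]
      simp only [e]
      exact sqrt_sum_sq_le_sum₂ _ fun i => abs_nonneg _
    calc f x ≤ ∑ j, ‖Torus.partialDeriv j v x‖ := h1
      _ ≤ ∑ j, ∑ i, |Torus.partialDeriv j v x i| := Finset.sum_le_sum fun j _ => h2 j
      _ = ∑ ki, F ki x := by rw [hF, ← Fintype.sum_prod_type']
  have hS_le : ∀ x i j, |Torus.partialDeriv i v x j + Torus.partialDeriv j v x i| ≤ 2 * g x := by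
    intro x i j
    have h1 : |(Torus.partialDeriv j v x i + Torus.partialDeriv i v x j) / 2| ≤ g x := by
      refine Real.abs_le_sqrt ?_
      refine le_trans ?_ (Finset.single_le_sum (f := fun i' => ∑ j',
        ((Torus.partialDeriv j' v x i' + Torus.partialDeriv i' v x j') / 2) ^ 2)
        (fun _ _ => Finset.sum_nonneg fun _ _ => sq_nonneg _) (Finset.mem_univ i))
      exact Finset.single_le_sum (f := fun j' =>
        ((Torus.partialDeriv j' v x i + Torus.partialDeriv i v x j') / 2) ^ 2)
        (fun _ _ => sq_nonneg _) (Finset.mem_univ j)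
    rw [abs_div, abs_two] at h1
    rw [add_comm]
    linarith
  -- Minkowski: `‖f‖_q ≤ ∑ₖᵢ ‖∂ₖvᵢ‖_q`
  have hFm : ∀ ki, AEStronglyMeasurable (F ki) volume :=
    fun ki => ((hDic ki.1 ki.2).abs).aestronglyMeasurable
  have hstep1 : eLpNorm f q volume ≤ ∑ ki, eLpNorm (F ki) q volume := by
    have h1 : eLpNorm f q volume ≤ eLpNorm (fun x => ∑ ki, F ki x) q volume :=
      eLpNorm_mono_real fun x => by
        rw [Real.norm_eq_abs, abs_of_nonneg (hf0 x)]
        exact hf_le x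
    have e : (fun x => ∑ ki, F ki x) = ∑ ki, F ki := by
      funext x
      simp only [Finset.sum_apply]
    rw [e] at h1
    exact h1.trans (eLpNorm_sum_le (fun ki _ => hFm ki) hq1.le)
  -- Calderón–Zygmund for each entry, and `‖(∂ᵢv)ⱼ + (∂ⱼv)ᵢ‖_q ≤ 2‖g‖_q`
  have hstep2 : ∀ ki, eLpNorm (F ki) q volume ≤ C * (3 * (2 * eLpNorm g q volume)) := by
    intro ki
    have h1 : eLpNorm (F ki) q volume ≤
        eLpNorm (fun x => Torus.partialDeriv ki.1 v x ki.2) q volume :=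
      eLpNorm_mono fun x => by simp [hF]
    have h2 := hC v hv hdiv ki.2 ki.1
    have h3 : ∑ j : Fin 3, eLpNorm (fun x => Torus.partialDeriv ki.2 v x j +
        Torus.partialDeriv j v x ki.2) q volume ≤ 3 * (2 * eLpNorm g q volume) := by
      have h4 : ∀ j, eLpNorm (fun x => Torus.partialDeriv ki.2 v x j +
          Torus.partialDeriv j v x ki.2) q volume ≤ 2 * eLpNorm g q volume := by
        intro j
        have h5 : eLpNorm (fun x => Torus.partialDeriv ki.2 v x j +
            Torus.partialDeriv j v x ki.2) q volume ≤ eLpNorm (fun x => 2 * g x) q volume :=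
          eLpNorm_mono_real fun x => by rw [Real.norm_eq_abs]; exact hS_le x ki.2 j
        have e : (fun x => 2 * g x) = (2 : ℝ) • g := rfl
        rw [e, eLpNorm_const_smul] at h5
        have e2 : ‖(2 : ℝ)‖ₑ = 2 := by
          rw [Real.enorm_eq_ofReal (by norm_num : (0:ℝ) ≤ 2)]; norm_num
        rwa [e2] at h5
      calc ∑ j : Fin 3, eLpNorm (fun x => Torus.partialDeriv ki.2 v x j +
            Torus.partialDeriv j v x ki.2) q volume
          ≤ ∑ _j : Fin 3, 2 * eLpNorm g q volume := Finset.sum_le_sum fun j _ => h4 j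
        _ = 3 * (2 * eLpNorm g q volume) := by
            rw [Finset.sum_const, Finset.card_univ, Fintype.card_fin, nsmul_eq_mul]; norm_num
    calc eLpNorm (F ki) q volume
        ≤ eLpNorm (fun x => Torus.partialDeriv ki.1 v x ki.2) q volume := h1
      _ ≤ C * ∑ j : Fin 3, eLpNorm (fun x => Torus.partialDeriv ki.2 v x j +
            Torus.partialDeriv j v x ki.2) q volume := h2
      _ ≤ C * (3 * (2 * eLpNorm g q volume)) := by gcongr
  have hmain : eLpNorm f q volume ≤ ((54 * C : ℝ≥0) : ℝ≥0∞) * eLpNorm g q volume := by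
    calc eLpNorm f q volume ≤ ∑ ki : Fin 3 × Fin 3, eLpNorm (F ki) q volume := hstep1
      _ ≤ ∑ _ki : Fin 3 × Fin 3, (C : ℝ≥0∞) * (3 * (2 * eLpNorm g q volume)) :=
          Finset.sum_le_sum fun ki _ => hstep2 ki
      _ = ((54 * C : ℝ≥0) : ℝ≥0∞) * eLpNorm g q volume := by
          rw [Finset.sum_const, Finset.card_univ, Fintype.card_prod, Fintype.card_fin, nsmul_eq_mul]
          push_cast
          ring
  -- Bochner form
  have conv : ∀ {φ : UnitAddTorus (Fin 3) → ℝ}, Continuous φ → (∀ x, 0 ≤ φ x) →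
      eLpNorm φ q volume = ENNReal.ofReal ((∫ x, φ x ^ s) ^ (1 / s)) := by
    intro φ hφ hφ0
    rw [MemLp.eLpNorm_eq_integral_rpow_norm hq0 hqtop.ne
      (hφ.memLp_of_hasCompactSupport (HasCompactSupport.of_compactSpace φ)), hqr, one_div]
    congr 2
    exact integral_congr_ae (ae_of_all _ fun x => by
      simp only [Real.norm_eq_abs, abs_of_nonneg (hφ0 x)])
  rw [conv hfc hf0, conv hgc hg0] at hmain
  have hB0 : 0 ≤ (∫ x, g x ^ s) ^ (1 / s) :=
    Real.rpow_nonneg (integral_nonneg fun x => Real.rpow_nonneg (hg0 x) _) _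
  have e : ((54 * C : ℝ≥0) : ℝ≥0∞) * ENNReal.ofReal ((∫ x, g x ^ s) ^ (1 / s)) =
      ENNReal.ofReal (54 * C * (∫ x, g x ^ s) ^ (1 / s)) := by
    rw [ENNReal.ofReal_mul (by positivity), ← ENNReal.ofReal_coe_nnreal]
    push_cast
    rfl
  rw [e] at hmain
  exact (ENNReal.ofReal_le_ofReal_iff (by positivity)).1 hmain

/-! ### The strain criterion on `T³`, continuation form -/

/-- **The strain criterion `S ∈ L^r(0,T;L^s)`, `2/r + 3/s = 2`, `3/2 < s < ∞`, on `T³`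
(continuation form)** — Beirão da Veiga's gradient criterion (1995; Robinson–Rodrigo–Sadowski
2016, Notes to Ch. 8, p. 135) composed with the Calderón–Zygmund bound
`‖∇u‖_{L^s} ≤ K_s‖S‖_{L^s}` for divergence-free fields (Miller 2020, §3). Let `(u, p)` be a
classical solution of the unforced Navier–Stokes equations with `ν > 0` on `[0, T) × T³`,
`T > 0`, with mean-zero velocity slices; let `3/2 < s` and let `N` be a continuous nonnegative
majorant of `‖S(t)‖_{L^s}` on `[0, T)`,
`(∫ (∑ᵢⱼ(((∂ⱼu)ᵢ + (∂ᵢu)ⱼ)/2)²)^{s/2})^{1/s} ≤ N(t)`, with `∫₀ᵗ N^{2s/(2s−3)} ≤ I` for all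
`t ∈ [0, T)` (`r = 2s/(2s−3)`, `2/r + 3/s = 2`). Then the solution continues to a classical
solution with mean-zero slices on some `[0, T'] × T³`, `T' > T`, equal to `u` on `[0, T)`.
[cite: BeiraoDaVeiga1995, Thm (restated RobinsonRodrigoSadowskiCUP2016 Notes to Ch. 8, p. 135)]
[cite: Miller2019, §3 (strain-to-gradient Calderón–Zygmund bound)] -/
theorem Torus.classicalNS_continuation_of_strainLs_rpow_integral_le
    {ν T s : ℝ} (hν : 0 < ν) (hT : 0 < T) (hs : 3 / 2 < s)
    {u : ℝ → UnitAddTorus (Fin 3) → EuclideanSpace ℝ (Fin 3)} {p : ℝ → UnitAddTorus (Fin 3) → ℝ}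
    (h : Torus.IsClassicalNSSolutionOn (Ico 0 T) ν 0 u p)
    (hmean : ∀ t ∈ Ico 0 T, Torus.HasZeroMean (u t)) {N : ℝ → ℝ}
    (hNc : ContinuousOn N (Ico 0 T)) (hN0 : ∀ t ∈ Ico 0 T, 0 ≤ N t)
    (hN : ∀ t ∈ Ico 0 T, (∫ x, Real.sqrt (∑ i, ∑ j,
      ((Torus.partialDeriv j (u t) x i + Torus.partialDeriv i (u t) x j) / 2) ^ 2) ^ s) ^ (1 / s) ≤
        N t)
    {I : ℝ} (hI : ∀ t ∈ Ico 0 T, ∫ τ in (0 : ℝ)..t, N τ ^ (2 * s / (2 * s - 3)) ≤ I) :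
    ∃ T' : ℝ, T < T' ∧ ∃ (u' : ℝ → UnitAddTorus (Fin 3) → EuclideanSpace ℝ (Fin 3))
      (p' : ℝ → UnitAddTorus (Fin 3) → ℝ),
      Torus.IsClassicalNSSolutionOn (Icc 0 T') ν 0 u' p' ∧
        (∀ t ∈ Icc 0 T', Torus.HasZeroMean (u' t)) ∧ ∀ t ∈ Ico 0 T, u' t = u t := by
  have hd : Fintype.card (Fin 3) = 3 := Fintype.card_fin 3
  obtain ⟨K, hK0, hK⟩ := Torus.exists_gradLs_le_strainLs (by linarith : (1 : ℝ) < s)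
  have h2s3 : 0 < 2 * s - 3 := by linarith
  set r : ℝ := 2 * s / (2 * s - 3) with hr
  have hr0 : 0 ≤ r := by rw [hr]; positivity
  refine Torus.classicalNS_continuation_of_gradLs_rpow_integral_le hd hν hT hs h hmean
    (N := fun t => K * N t) (continuousOn_const.mul hNc) (fun t ht => mul_nonneg hK0 (hN0 t ht))
    (fun t ht => ?_) (I := K ^ r * I) (fun t ht => ?_)
  · have hut : Torus.IsSmooth (u t) := h.smooth_velocity.isSmooth_slice ht
    exact (hK (u t) hut (h.divFree t ht)).trans (mul_le_mul_of_nonneg_left (hN t ht) hK0)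
  · have ht0 : 0 ≤ t := ht.1
    have e : ∫ τ in (0 : ℝ)..t, (K * N τ) ^ r = ∫ τ in (0 : ℝ)..t, K ^ r * N τ ^ r := by
      refine intervalIntegral.integral_congr fun τ hτ => ?_
      rw [uIcc_of_le ht0] at hτ
      have hτ' : τ ∈ Ico 0 T := ⟨hτ.1, hτ.2.trans_lt ht.2⟩
      exact Real.mul_rpow hK0 (hN0 τ hτ')
    rw [e, intervalIntegral.integral_const_mul]
    exact mul_le_mul_of_nonneg_left (hI t ht) (Real.rpow_nonneg hK0 _)

end Literature.Analysis.FluidPDE
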